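import Literature.AlgebraicGeometry.Resolution.AffineBlowupAlgebra
import Mathlib.RingTheory.MvPolynomial.Basic
import Mathlib.Algebra.MvPolynomial.CommRing
import Mathlib.RingTheory.Ideal.Quotient.Operations
import Mathlib.RingTheory.Localization.Away.Basic
import Summits.ResolutionOfSingularities.ResolutionOfSingularities.Theorems.FrobeniusLadderFInjectiveMacaulayficationE8Char5FiModel
import HarnessLib

/-!
# Strict-transform presentation of the point-blow-up charts of a hypersurface in `𝔸ⁿ`

Support file for crux stmt-ResolutionOfSingularities-15315
(`FrobeniusLadder.FInjectiveMacaulayfication`, line `Sketch`, lead seat c7, cycle 8):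
stub `stub_strictTransformChartN` of the §13 THREEFOLD CALIBRATION package — the `Fin n` port of
`StrictTransformChart.stub_strictTransformChart` (p137901, the case `n = 3`), whose proofs never used
`3`; the lead needs `n = 4` (a threefold in `𝔸⁴`).

Let `S = k[X₀, …, X_{n-1}]`, `R = S/(f)` a hypersurface, `π : S → R`, `x j = π(X j)`,
`𝔪 = (x₀, …, x_{n-1})`, `a = x i`. The chart `D₊(a t)` of the blowing up
`Bl_𝔪(Spec R) = Proj R[𝔪t]` has coordinate ring `A_i = (R[𝔪t])_{(at)}`
(`HomogeneousLocalization.Away (reesGrading 𝔪) (reesT a _)`), identified with the affine blowup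
algebra `R[𝔪/a] ⊆ R[1/a]` by `reesChartEquiv` (`AffineBlowupAlgebra.lean`). We prove the classical
STRICT TRANSFORM presentation: if the chart substitution `θ : X i ↦ X i, X j ↦ X j X i (j ≠ i)`
satisfies `θ f = X i ^ μ · g` with `(g)` prime and `X i ∉ (g)`, then `A_i ≅ S/(g)`, the class of
`X i` corresponding to the exceptional equation `a/1 = reesChartBase a _ a`.

Proof layout. Let `ψ : S → R[1/a]`, `X i ↦ a`, `X j ↦ x j / a` (`j ≠ i`), constants `c ↦ π(c)`.
* `exists_pow_mul_eq` — clearing denominators: every `h ∈ S` satisfies `X i ^ N · h = θ H` for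
  some `N`, `H`;
* `comp_eq` — `ψ ∘ θ = (R → R[1/a]) ∘ π` (check on variables);
* `map_eq_zero_of_transform` — `ψ g = 0` (`a^μ ψ(g) = ψ(θ f) = π(f) = 0`, `a` a unit of `R[1/a]`);
* `mem_span_of_map_eq_zero` — `ker ψ ⊆ (g)`: if `ψ h = 0` and `X i ^ N h = θ H` then `π H = 0` in
  `R[1/a]`, so `aᵐ π(H) = 0`, `X i ^ m H ∈ (f)`, and applying `θ`: `X i ^ (m+N) h ∈ (g)`;
  conclude by primality of `(g)` and `X i ∉ (g)`;
* `map_mem_blowupAlgebra`, `exists_map_eq_of_mem_blowupAlgebra` — `ψ(S) = R[𝔪/a]`;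
* `exists_ringEquiv` — assembly `S/(g) ≅ S/ker ψ ≅ R[𝔪/a] ≅ A_i` and evaluation at `X i`;
* `stub_strictTransformChartN` — the registered stub (`R = S/(f)`, `π` the quotient map);
* `chart_clause_of_presentationN` (ride-along) — the chart dictionary
  `E7Char3FiModel.chart_clause_of_presentation` for `Fin n` and a general exponent base `p`: the
  presentation carries "the clause at the maximal ideals of `S/(g)` containing `X̄ᵢ`" to "the clause
  at the maximal ideals of `A_i` containing `x̄ᵢ/1`" (`E8Char5FiModel.clause_maximal_of_ringEquiv`).

References: The Stacks Project, Tag 0804 (blowing up is `Proj` of the Rees algebra, the charts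
`Spec R[I/a]`), Tag 052Q (affine blowup algebras); R. Hartshorne, *Algebraic Geometry*, I.4, and
J. Kollár, *Lectures on Resolution of Singularities*, §2.5 (strict transforms of hypersurfaces under
point blow-ups) for context; the statement itself is folklore.
-/

-- single-problem summit: the doubled namespace component is forced
set_option linter.dupNamespace false

noncomputable section

namespace Summit.ResolutionOfSingularities.ResolutionOfSingularities.Theorems.FInjectiveMacaulayfication.StrictTransformChartN

open Literature.AlgebraicGeometry.Resolution MvPolynomial

section Substitution

variable {k : Type*} [CommRing k] {n : ℕ} {i : Fin n}
  (θ : MvPolynomial (Fin n) k →+* MvPolynomial (Fin n) k)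

/-- **Clearing denominators** for the chart substitution `θ : X i ↦ X i, X j ↦ X j X i`, `c ↦ c`:
every polynomial `h` satisfies `X i ^ N · h = θ H` for some `N` and `H`. [folklore] -/
theorem exists_pow_mul_eq (hθC : ∀ c : k, θ (C c) = C c) (hθi : θ (X i) = X i)
    (hθj : ∀ j : Fin n, j ≠ i → θ (X j) = X j * X i) (h : MvPolynomial (Fin n) k) :
    ∃ (N : ℕ) (H : MvPolynomial (Fin n) k), X i ^ N * h = θ H := by
  induction h using MvPolynomial.induction_on with
  | C c => exact ⟨0, C c, by rw [pow_zero, one_mul, hθC]⟩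
  | add p q hp hq =>
    obtain ⟨N₁, H₁, h₁⟩ := hp
    obtain ⟨N₂, H₂, h₂⟩ := hq
    refine ⟨N₁ + N₂, X i ^ N₂ * H₁ + X i ^ N₁ * H₂, ?_⟩
    rw [map_add, map_mul, map_mul, map_pow, map_pow, hθi, ← h₁, ← h₂]
    ring
  | mul_X p l hp =>
    obtain ⟨N, H, hH⟩ := hp
    by_cases hl : l = i
    · refine ⟨N, H * X i, ?_⟩
      rw [hl, map_mul, hθi, ← hH]
      ring
    · refine ⟨N + 1, H * X l, ?_⟩
      rw [map_mul, hθj l hl, ← hH]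
      ring

end Substitution

section Chart

variable {k : Type*} [CommRing k] {R : Type*} [CommRing R] {n : ℕ}
  (π : MvPolynomial (Fin n) k →+* R)
  (x : Fin n → R) {i : Fin n}
  (ψ : MvPolynomial (Fin n) k →+* Localization.Away (x i))

/-- **`ψ ∘ θ = (R → R[1/a]) ∘ π`** for `ψ : X i ↦ a = x i`, `X j ↦ x j / a`, `c ↦ π c` and the chart
substitution `θ`: both sides agree on constants and on the variables (`(x j / a) · a = x j`).
[folklore] -/
theorem comp_eq (hx : ∀ j, x j = π (X j))
    (hψC : ∀ c, ψ (C c) = algebraMap R (Localization.Away (x i)) (π (C c)))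
    (hψi : ψ (X i) = algebraMap R (Localization.Away (x i)) (x i))
    (hψj : ∀ j, j ≠ i → ψ (X j) =
      algebraMap R (Localization.Away (x i)) (x j) * IsLocalization.Away.invSelf (x i))
    (θ : MvPolynomial (Fin n) k →+* MvPolynomial (Fin n) k) (hθC : ∀ c : k, θ (C c) = C c)
    (hθi : θ (X i) = X i) (hθj : ∀ j : Fin n, j ≠ i → θ (X j) = X j * X i) :
    ψ.comp θ = (algebraMap R (Localization.Away (x i))).comp π := by
  refine MvPolynomial.ringHom_ext (fun c => ?_) (fun j => ?_)
  · rw [RingHom.comp_apply, hθC, hψC, RingHom.comp_apply]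
  · rw [RingHom.comp_apply, RingHom.comp_apply, ← hx]
    by_cases hj : j = i
    · rw [hj, hθi, hψi]
    · rw [hθj j hj, map_mul, hψi, hψj j hj, div_mul_algebraMap]

/-- **The strict transform equation dies on the chart**: if `θ f = X i ^ μ · g` and `π f = 0`, then
`ψ g = 0`, because `a ^ μ · ψ g = ψ (θ f) = π f = 0` in `R[1/a]` and `a` is a unit there.
[folklore] -/
theorem map_eq_zero_of_transform (hψi : ψ (X i) = algebraMap R (Localization.Away (x i)) (x i))
    (θ : MvPolynomial (Fin n) k →+* MvPolynomial (Fin n) k)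
    (hcomp : ψ.comp θ = (algebraMap R (Localization.Away (x i))).comp π)
    {f g : MvPolynomial (Fin n) k} {μ : ℕ} (hθf : θ f = X i ^ μ * g) (hπf : π f = 0) :
    ψ g = 0 := by
  have h := RingHom.congr_fun hcomp f
  rw [RingHom.comp_apply, RingHom.comp_apply, hθf, hπf, map_zero, map_mul, map_pow, hψi] at h
  exact ((IsLocalization.Away.algebraMap_isUnit (S := Localization.Away (x i)) (x i)).pow μ)
    |>.mul_right_eq_zero.mp h

/-- **`ker ψ ⊆ (g)`**: if `ψ h = 0`, clear denominators (`X i ^ N · h = θ H`), so `π H ↦ 0` in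
`R[1/a]`, hence `a ^ m · π H = 0`, i.e. `X i ^ m · H ∈ ker π = (f)`; applying `θ` gives
`X i ^ (m + N) · h ∈ (θ f) ⊆ (g)`, and `(g)` is prime with `X i ∉ (g)`. [folklore] -/
theorem mem_span_of_map_eq_zero (hx : ∀ j, x j = π (X j))
    (θ : MvPolynomial (Fin n) k →+* MvPolynomial (Fin n) k) (hθC : ∀ c : k, θ (C c) = C c)
    (hθi : θ (X i) = X i) (hθj : ∀ j : Fin n, j ≠ i → θ (X j) = X j * X i)
    (hcomp : ψ.comp θ = (algebraMap R (Localization.Away (x i))).comp π)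
    {f g : MvPolynomial (Fin n) k} {μ : ℕ} (hθf : θ f = X i ^ μ * g)
    (hπ : ∀ s, π s = 0 → s ∈ Ideal.span {f}) (hg : (Ideal.span {g}).IsPrime)
    (hXi : X i ∉ Ideal.span {g}) {h : MvPolynomial (Fin n) k} (hh : ψ h = 0) :
    h ∈ Ideal.span {g} := by
  obtain ⟨N, H, hH⟩ := exists_pow_mul_eq θ hθC hθi hθj h
  have h1 : algebraMap R (Localization.Away (x i)) (π H) = 0 := by
    have h1 := RingHom.congr_fun hcomp H
    rw [RingHom.comp_apply, RingHom.comp_apply, ← hH, map_mul, hh, mul_zero] at h1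
    exact h1.symm
  obtain ⟨⟨_, m, rfl⟩, hm⟩ :=
    (IsLocalization.map_eq_zero_iff (Submonoid.powers (x i)) (Localization.Away (x i)) _).mp h1
  change x i ^ m * π H = 0 at hm
  have h2 : X i ^ m * H ∈ Ideal.span {f} := hπ _ (by rw [map_mul, map_pow, ← hx]; exact hm)
  obtain ⟨c, hc⟩ := Ideal.mem_span_singleton'.mp h2
  have h3 := congrArg θ hc
  rw [map_mul, map_mul, map_pow, hθi, hθf, ← hH] at h3
  have h4 : X i ^ (m + N) * h ∈ Ideal.span {g} := by
    rw [pow_add, mul_assoc, ← h3]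
    exact Ideal.mul_mem_left _ _ (Ideal.mul_mem_left _ _ (Ideal.mem_span_singleton_self g))
  rcases hg.mem_or_mem h4 with h5 | h5
  · exact absurd (hg.mem_of_pow_mem _ h5) hXi
  · exact h5

/-- **`ψ(S) ⊆ R[𝔪/a]`** (`𝔪 = (x₀, …, x_{n-1})`, `a = x i`): the values `ψ(c) = π c`, `ψ(X i) = a`,
`ψ(X j) = x j / a` lie in the affine blowup algebra. [folklore] -/
theorem map_mem_blowupAlgebra
    (hψC : ∀ c, ψ (C c) = algebraMap R (Localization.Away (x i)) (π (C c)))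
    (hψi : ψ (X i) = algebraMap R (Localization.Away (x i)) (x i))
    (hψj : ∀ j, j ≠ i → ψ (X j) =
      algebraMap R (Localization.Away (x i)) (x j) * IsLocalization.Away.invSelf (x i))
    (h : MvPolynomial (Fin n) k) : ψ h ∈ blowupAlgebra (Ideal.span (Set.range x)) (x i) := by
  induction h using MvPolynomial.induction_on with
  | C c =>
    rw [hψC]
    exact Subalgebra.algebraMap_mem _ _
  | add p q hp hq =>
    rw [map_add]
    exact Subalgebra.add_mem _ hp hq
  | mul_X p l hp =>
    rw [map_mul]
    refine Subalgebra.mul_mem _ hp ?_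
    by_cases hl : l = i
    · rw [hl, hψi]
      exact Subalgebra.algebraMap_mem _ _
    · rw [hψj l hl]
      exact div_mem_blowupAlgebra _ _ (Ideal.subset_span (Set.mem_range_self l))

/-- **`R[𝔪/a] ⊆ ψ(S)`**: `ψ(S)` is an `R`-subalgebra of `R[1/a]` (it contains `R`, as `π` followed
by `R → R[1/a]` factors through `ψ`) containing the generators `c / a`, `c ∈ 𝔪` (as
`x j / a = ψ(X j)` for `j ≠ i` and `x i / a = 1`). [folklore] -/
theorem exists_map_eq_of_mem_blowupAlgebra
    (hψj : ∀ j, j ≠ i → ψ (X j) =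
      algebraMap R (Localization.Away (x i)) (x j) * IsLocalization.Away.invSelf (x i))
    (hι : ∀ r : R, ∃ s : MvPolynomial (Fin n) k, ψ s = algebraMap R (Localization.Away (x i)) r)
    {y : Localization.Away (x i)} (hy : y ∈ blowupAlgebra (Ideal.span (Set.range x)) (x i)) :
    ∃ s : MvPolynomial (Fin n) k, ψ s = y := by
  let T : Subalgebra R (Localization.Away (x i)) :=
    { carrier := Set.range ψ
      mul_mem' := by
        rintro _ _ ⟨y₁, rfl⟩ ⟨y₂, rfl⟩
        exact ⟨y₁ * y₂, map_mul _ _ _⟩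
      one_mem' := ⟨1, map_one _⟩
      add_mem' := by
        rintro _ _ ⟨y₁, rfl⟩ ⟨y₂, rfl⟩
        exact ⟨y₁ + y₂, map_add _ _ _⟩
      zero_mem' := ⟨0, map_zero _⟩
      algebraMap_mem' := hι }
  have hgen : ∀ j, algebraMap R _ (x j) * IsLocalization.Away.invSelf (x i) ∈ T := by
    intro j
    by_cases hj : j = i
    · rw [hj, IsLocalization.Away.mul_invSelf]
      exact one_mem T
    · exact ⟨X j, hψj j hj⟩
  have hle : blowupAlgebra (Ideal.span (Set.range x)) (x i) ≤ T := by
    change Algebra.adjoin R (blowupAlgebraGens (Ideal.span (Set.range x)) (x i)) ≤ T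
    refine Algebra.adjoin_le ?_
    rintro _ ⟨c, hc, rfl⟩
    change algebraMap R _ c * IsLocalization.Away.invSelf (x i) ∈ T
    induction hc using Submodule.span_induction with
    | mem c hc =>
      obtain ⟨j, rfl⟩ := hc
      exact hgen j
    | zero =>
      rw [map_zero, zero_mul]
      exact zero_mem T
    | add c₁ c₂ _ _ h₁ h₂ =>
      rw [map_add, add_mul]
      exact add_mem h₁ h₂
    | smul r c _ hc =>
      rw [smul_eq_mul, map_mul, mul_assoc]
      exact mul_mem (Subalgebra.algebraMap_mem T r) hc
  exact hle hy

end Chart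

section Assembly

variable {k : Type*} [CommRing k] {R : Type*} [CommRing R] {n : ℕ}

/-- **Strict-transform presentation of a blow-up chart** (abstract form): for a surjection
`π : k[X₀, …, X_{n-1}] → R` with kernel `(f)`, `x j = π (X j)`, `𝔪 = (x₀, …, x_{n-1})`, and a ring
endomorphism `θ` of `k[X₀, …, X_{n-1}]` fixing constants and `X i` and sending `X j ↦ X j X i`
(`j ≠ i`) with `θ f = X i ^ μ · g`, `(g)` prime, `X i ∉ (g)`: the chart ring `(R[𝔪t])_{(x i · t)}`
of `Bl_𝔪(Spec R)` is `k[X₀, …, X_{n-1}]/(g)`, the class of `X i` going to `x i / 1`.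
[cite: StacksProject, Tag 0804] -/
theorem exists_ringEquiv (π : MvPolynomial (Fin n) k →+* R) (hπs : Function.Surjective π)
    (x : Fin n → R) {i : Fin n} (hx : ∀ j, x j = π (X j)) {f g : MvPolynomial (Fin n) k} {μ : ℕ}
    (hπ : ∀ s, π s = 0 ↔ s ∈ Ideal.span {f}) (hg : (Ideal.span {g}).IsPrime)
    (hXi : X i ∉ Ideal.span {g}) (θ : MvPolynomial (Fin n) k →+* MvPolynomial (Fin n) k)
    (hθC : ∀ c : k, θ (C c) = C c) (hθi : θ (X i) = X i)
    (hθj : ∀ j : Fin n, j ≠ i → θ (X j) = X j * X i) (hθf : θ f = X i ^ μ * g) :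
    ∃ e : (MvPolynomial (Fin n) k ⧸ Ideal.span {g}) ≃+*
        HomogeneousLocalization.Away (reesGrading (Ideal.span (Set.range x)))
          (reesT (x i) (Ideal.subset_span (Set.mem_range_self i))),
      e (Ideal.Quotient.mk (Ideal.span {g}) (X i)) =
        reesChartBase (x i) (Ideal.subset_span (Set.mem_range_self i)) (x i) := by
  have ha : x i ∈ Ideal.span (Set.range x) := Ideal.subset_span (Set.mem_range_self i)
  -- the substitution `ψ : X i ↦ a, X j ↦ x j / a, c ↦ π c`
  let ψ : MvPolynomial (Fin n) k →+* Localization.Away (x i) :=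
    MvPolynomial.eval₂Hom ((algebraMap R (Localization.Away (x i))).comp (π.comp MvPolynomial.C))
      fun j => if j = i then algebraMap R (Localization.Away (x i)) (x i)
        else algebraMap R (Localization.Away (x i)) (x j) * IsLocalization.Away.invSelf (x i)
  have hψC : ∀ c, ψ (C c) = algebraMap R (Localization.Away (x i)) (π (C c)) := fun c =>
    MvPolynomial.eval₂Hom_C _ _ c
  have hψi : ψ (X i) = algebraMap R (Localization.Away (x i)) (x i) := by
    simp [ψ]
  have hψj : ∀ j, j ≠ i → ψ (X j) =
      algebraMap R (Localization.Away (x i)) (x j) * IsLocalization.Away.invSelf (x i) := by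
    intro j hj
    simp [ψ, hj]
  have hcomp := comp_eq π x ψ hx hψC hψi hψj θ hθC hθi hθj
  have hι : ∀ r : R, ∃ s, ψ s = algebraMap R (Localization.Away (x i)) r := by
    intro r
    obtain ⟨s, rfl⟩ := hπs r
    exact ⟨θ s, RingHom.congr_fun hcomp s⟩
  have hmem := map_mem_blowupAlgebra π x ψ hψC hψi hψj
  -- `ψ` with codomain restricted to `R[𝔪/a]`: surjective with kernel `(g)`
  let ψ' : MvPolynomial (Fin n) k →+* blowupAlgebra (Ideal.span (Set.range x)) (x i) :=
    ψ.codRestrict (blowupAlgebra (Ideal.span (Set.range x)) (x i)).toSubring hmem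
  have hsurj : Function.Surjective ψ' := fun z => by
    obtain ⟨s, hs⟩ := exists_map_eq_of_mem_blowupAlgebra x ψ hψj hι z.2
    exact ⟨s, Subtype.ext hs⟩
  have hker : RingHom.ker ψ' = Ideal.span {g} := by
    apply le_antisymm
    · intro h hh
      exact mem_span_of_map_eq_zero π x ψ hx θ hθC hθi hθj hcomp hθf (fun s => (hπ s).mp) hg hXi
        (congrArg Subtype.val (RingHom.mem_ker.mp hh))
    · rw [Ideal.span_le, Set.singleton_subset_iff, SetLike.mem_coe, RingHom.mem_ker]
      exact Subtype.ext (map_eq_zero_of_transform π x ψ hψi θ hcomp hθf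
        ((hπ f).mpr (Ideal.mem_span_singleton_self f)))
  refine ⟨(Ideal.quotEquivOfEq hker.symm).trans
    ((RingHom.quotientKerEquivOfSurjective hsurj).trans (reesChartEquiv (x i) ha).symm), ?_⟩
  rw [RingEquiv.trans_apply, RingEquiv.trans_apply, Ideal.quotEquivOfEq_mk,
    RingHom.quotientKerEquivOfSurjective_apply_mk, RingEquiv.symm_apply_eq,
    reesChartEquiv_reesChartBase]
  exact Subtype.ext hψi

end Assembly

/-- STRICT TRANSFORM CHART in `𝔸ⁿ` (stub `stub_strictTransformChartN` of line `Sketch`): for a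
hypersurface `R = k[X₀, …, X_{n-1}]/(f)` with `(f)` prime, `x j` the classes of the variables and
`𝔪 = (x₀, …, x_{n-1})`, if the chart substitution `θᵢ : X i ↦ X i, X j ↦ X j X i` gives
`θᵢ f = X i ^ μ · g` with `(g)` prime and `X i ∉ (g)`, then the chart ring `(R[𝔪t])_{(x i · t)}` of
the point blow-up `Bl_𝔪(Spec R)` is `k[X₀, …, X_{n-1}]/(g)` (the strict transform), the class of
`X i` being the exceptional equation `x i / 1`. [cite: StacksProject, Tag 0804] -/
theorem stub_strictTransformChartN : ∀ (k : Type) [Field k] (n : ℕ) (f g : MvPolynomial (Fin n) k) (i : Fin n) (μ : ℕ),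
    (Ideal.span {f}).IsPrime → f ≠ 0 → (Ideal.span {g}).IsPrime → MvPolynomial.X i ∉ Ideal.span {g} →
    MvPolynomial.aeval (fun j : Fin n => if j = i then (MvPolynomial.X i : MvPolynomial (Fin n) k)
        else MvPolynomial.X j * MvPolynomial.X i) f = MvPolynomial.X i ^ μ * g →
    ∀ (x : Fin n → MvPolynomial (Fin n) k ⧸ Ideal.span {f}),
      x = (fun j : Fin n => Ideal.Quotient.mk (Ideal.span {f}) (MvPolynomial.X j)) →
      ∃ e : (MvPolynomial (Fin n) k ⧸ Ideal.span {g}) ≃+*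
          HomogeneousLocalization.Away (reesGrading (Ideal.span (Set.range x)))
            (reesT (x i) (Ideal.subset_span (Set.mem_range_self i))),
        e (Ideal.Quotient.mk (Ideal.span {g}) (MvPolynomial.X i)) =
          reesChartBase (x i) (Ideal.subset_span (Set.mem_range_self i)) (x i) := by
  intro k _ n f g i μ _ _ hg hXi hθf x hx
  exact exists_ringEquiv (Ideal.Quotient.mk (Ideal.span {f})) Ideal.Quotient.mk_surjective x
    (fun j => congrFun hx j) (fun s => Ideal.Quotient.eq_zero_iff_mem) hg hXi
    (MvPolynomial.aeval fun j : Fin n =>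
      if j = i then (X i : MvPolynomial (Fin n) k) else X j * X i).toRingHom
    (fun c => MvPolynomial.algHom_C _ c) ((MvPolynomial.aeval_X _ i).trans (if_pos rfl))
    (fun j hj => (MvPolynomial.aeval_X _ j).trans (if_neg hj)) hθf

-- budget: the chart-ring types make every unification step on this statement expensive (≈ 3× default)
set_option maxHeartbeats 800000 in
/-- The chart dictionary for a VARIABLE chart index `i`, exponent base `p` and dimension `n`
(`E7Char3FiModel.chart_clause_of_presentation` is the case `n = 3`,
`E8Char5FiModel.chart_clause_of_presentation` the case `n = 3`, `p = 5`): a strict-transform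
presentation `k[X]/(g) ≅ A_i = (R[𝔪t])_{(x̄ᵢt)}` (`stub_strictTransformChartN`) carries "the clause
at the maximal ideals of `k[X]/(g)` containing `X̄ᵢ`" to "the clause at the maximal ideals of `A_i`
containing `x̄ᵢ/1`" (`E8Char5FiModel.clause_maximal_of_ringEquiv`). [folklore] -/
theorem chart_clause_of_presentationN (p : ℕ) (k : Type) [Field k] (n : ℕ)
    (f : MvPolynomial (Fin n) k) (hfprime : (Ideal.span {f}).IsPrime) (hf0 : f ≠ 0)
    (x : Fin n → MvPolynomial (Fin n) k ⧸ Ideal.span {f})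
    (hx : x = fun j : Fin n => Ideal.Quotient.mk (Ideal.span {f}) (MvPolynomial.X j))
    (i : Fin n) (g : MvPolynomial (Fin n) k) (μ : ℕ) (hg : (Ideal.span {g}).IsPrime)
    (hXg : MvPolynomial.X i ∉ Ideal.span {g})
    (hθ : MvPolynomial.aeval (fun j : Fin n => if j = i then (MvPolynomial.X i : MvPolynomial (Fin n) k)
        else MvPolynomial.X j * MvPolynomial.X i) f = MvPolynomial.X i ^ μ * g)
    (hpts : ∀ (Q' : Ideal (MvPolynomial (Fin n) k ⧸ Ideal.span {g})) [Q'.IsMaximal],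
        Ideal.Quotient.mk (Ideal.span {g}) (MvPolynomial.X i) ∈ Q' →
        ∀ d : ℕ, ringKrullDim (Localization.AtPrime Q') = d → ∀ s : Fin d → Localization.AtPrime Q',
          (Ideal.span (Set.range s)).radical.IsMaximal →
            RingTheory.Sequence.IsWeaklyRegular (Localization.AtPrime Q') (List.ofFn s) ∧
            ∀ y : Localization.AtPrime Q', (∃ e : ℕ, y ^ p ^ e ∈ Ideal.span
              ((fun z : Localization.AtPrime Q' => z ^ p ^ e) ''
                (Ideal.span (Set.range s) : Set (Localization.AtPrime Q')))) → y ∈ Ideal.span (Set.range s))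
    (Q : Ideal (HomogeneousLocalization.Away (reesGrading (Ideal.span (Set.range x)))
          (reesT (x i) (Ideal.subset_span (Set.mem_range_self i))))) [Q.IsMaximal]
    (huQ : reesChartBase (x i) (Ideal.subset_span (Set.mem_range_self i)) (x i) ∈ Q) :
    ∀ d : ℕ, ringKrullDim (Localization.AtPrime Q) = d → ∀ s : Fin d → Localization.AtPrime Q,
      (Ideal.span (Set.range s)).radical.IsMaximal →
        RingTheory.Sequence.IsWeaklyRegular (Localization.AtPrime Q) (List.ofFn s) ∧
        ∀ y : Localization.AtPrime Q, (∃ e : ℕ, y ^ p ^ e ∈ Ideal.span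
          ((fun z : Localization.AtPrime Q => z ^ p ^ e) ''
            (Ideal.span (Set.range s) : Set (Localization.AtPrime Q)))) → y ∈ Ideal.span (Set.range s) := by
  obtain ⟨e, he⟩ := stub_strictTransformChartN k n f g i μ hfprime hf0 hg hXg hθ x hx
  -- (elaborate the transported clause WITHOUT the goal as expected type, then close by `exact`: the other
  -- order makes the unifier compare instance paths on the chart ring and times out)
  have key := E8Char5FiModel.clause_maximal_of_ringEquiv p e _ _ he (fun Q' _ hQ' => hpts Q' hQ') Q huQ
  exact key

end Summit.ResolutionOfSingularities.ResolutionOfSingularities.Theorems.FInjectiveMacaulayfication.StrictTransformChartN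

end
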